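import Summits.AtomisticToContinuum.FouriersLaw.Theorems.BondHeatUncertaintyExtensiveSnapshotIrreversibilityCorrectorIntegrability
import Summits.AtomisticToContinuum.FouriersLaw.Theorems.BondHeatUncertaintyExtensiveSnapshotIrreversibilityCorrectorCutIdentity
import Summits.AtomisticToContinuum.FouriersLaw.Theorems.BondHeatUncertaintyExtensiveSnapshotIrreversibilityLateOddResponseOfFisher
import Summits.AtomisticToContinuum.FouriersLaw.Theorems.BoundaryEscapeDeficitBoundaryKernelBasics
import HarnessLib

/-!
# Crux `ExtensiveSnapshotIrreversibility` (stmt-AtomisticToContinuum-9121), line `clausius-budget-sound-window`: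
stub S4s `stub_correctorHeatSplit` — the McLennan corrector splits through the one-bath heat committors

Registered stub of the lead's checked skeleton (v6) of the line, proved verbatim (name + signature) so that
`ledger propose --supports stmt-AtomisticToContinuum-9121` accepts it.

Content (fixed `N ≥ 2`, bookkeeping only). For the pinned chain `P = pinnedChain ω₂ lam β γ` with both
baths at `T > 0` (equilibrium kernels `P_t = P.transitionKernel N T T t`, Gibbs state `μ_T`), given (MIX) =
CEHR (2.5) in the `e^{ϑH}`-weighted norm: the ONE-BATH HEAT SOURCES `f_L = γ(p_0² − T)`,
`f_R = γ(p_{N−1}² − T)` are continuous, centred (`μ_T(p_i²) = T`, equipartition) and dominated by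
`γ(2/ϑ + T) e^{ϑH}`; hence (`corrector_window_of_decay`, the tool of the landed S2a) their Kubo integrals
`Q_L = ∫₀^∞ P_s f_L ds`, `Q_R = ∫₀^∞ P_s f_R ds` (the heat committors: expected total heat eventually
absorbed by the left / right bath from the start `z`) converge absolutely and lie in `L²(μ_T)`. Since the
McLennan source is `g = (γ/2T²)(p_0² − p_{N−1}²) = (f_L − f_R)/(2T²)` POINTWISE, linearity of the two
integrals (`dP_s(z, ·)` and `ds`) gives the pointwise splitting of the corrector `w = (Q_L − Q_R)/(2T²)`, and
`(a − b)² ≤ 2a² + 2b²` gives `‖w‖² ≤ (‖Q_L‖² + ‖Q_R‖²)/(2T⁴)` in `L²(μ_T)`. (INV) is not used.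

References: N. Cuneo, J.-P. Eckmann, M. Hairer, L. Rey-Bellet, EJP 23 (2018) no. 55, Thm 2.13 (3) eq. (2.5),
§3 eq. (3.4); J. A. McLennan, Phys. Rev. 115 (1959).
-/

noncomputable section

namespace Summit.AtomisticToContinuum.FouriersLaw.Theorems.ExtensiveSnapshotIrreversibility.ClausiusBudget

open MeasureTheory ProbabilityTheory Filter Topology Set
open scoped ENNReal NNReal
open Literature.MathematicalPhysics.KineticTheory.HeatConduction
open Summit.AtomisticToContinuum.FouriersLaw.Theorems.SubdiffusiveBondHeat
  (pinnedChain_integral_kinObs_gibbsMeasure abs_sq_momentum_sub_le_exp)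

/-- **S4s `stub_correctorHeatSplit` (crux `ExtensiveSnapshotIrreversibility`, line
`clausius-budget-sound-window`).** For the pinned chain `P = pinnedChain ω₂ lam β γ` (`ω₂, lam, β, γ > 0`,
`N ≥ 2`, both baths at `T > 0`; kernels `P_t = P.transitionKernel N T T t`, Gibbs state `μ_T`), ASSUME (INV)
`μ_T P_t = μ_T` (not used) and (MIX) CEHR (2.5): for `0 < ϑ < 1/T` there are `C, c > 0` with
`|P_t f(z) − μ_T(f)| ≤ C e^{ϑH(z)} e^{−ct}` for continuous `|f| ≤ e^{ϑH}`. With the McLennan corrector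
`w z = ∫_{(0,∞)} P_{s⁺} g(z) ds`, `g = (γ/2T²)(p_0² − p_{N−1}²)`, and the one-bath heat committors
`Q_L z = ∫_{(0,∞)} P_{s⁺} f_L(z) ds`, `Q_R z = ∫_{(0,∞)} P_{s⁺} f_R(z) ds`, `f_L = γ(p_0² − T)`,
`f_R = γ(p_{N−1}² − T)`: both `ds`-integrals converge absolutely at every `z`, `Q_L, Q_R ∈ L²(μ_T)`,
`w = (Q_L − Q_R)/(2T²)` pointwise, and `∫ w² dμ_T ≤ (∫ Q_L² dμ_T + ∫ Q_R² dμ_T)/(2T⁴)`.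
Proof: `μ_T(f_i) = 0` (equipartition, `pinnedChain_integral_kinObs_gibbsMeasure`) and
`|f_i| ≤ γ(2/ϑ + T) e^{ϑH}` (`abs_sq_momentum_sub_le_exp`, `ϑ = 1/(4T)`) turn (MIX) into the decay
`|P_t f_i(z)| ≤ γ(2/ϑ + T) C e^{ϑH(z)} e^{−ct}` (`abs_act_sub_mean_le_of_mix`), so `corrector_window_of_decay`
applies to `f_L` and to `f_R`; then `g = (f_L − f_R)/(2T²)` pointwise, `integral_sub` twice, and
`∫(a − b)² ≤ 2∫a² + 2∫b²`. [cite: CuneoEckmannHairerReyBellet2018, Thm 2.13 (3) eq. (2.5) and §3 eq. (3.4)] -/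
theorem stub_correctorHeatSplit :
    ∀ ω₂ lam β γ : ℝ, 0 < ω₂ → 0 < lam → 0 < β → 0 < γ → ∀ T : ℝ, 0 < T → ∀ (N : ℕ) (hN : 2 ≤ N),
      let P := pinnedChain ω₂ lam β γ
      let μT := P.gibbsMeasure N T
      (∀ t : ℝ≥0, μT.bind (P.transitionKernel N T T t) = μT) →
      (∀ ϑ : ℝ, 0 < ϑ → ϑ < 1 / T → ∃ C c : ℝ, 0 < C ∧ 0 < c ∧
        ∀ (z : PhaseSpace N) (t : ℝ≥0) (f : PhaseSpace N → ℝ), Continuous f →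
          (∀ y, |f y| ≤ Real.exp (ϑ * P.hamiltonian N y)) →
          |(∫ y, f y ∂(P.transitionKernel N T T t z)) - ∫ y, f y ∂μT| ≤
            C * Real.exp (ϑ * P.hamiltonian N z) * Real.exp (-c * t)) →
      let g : PhaseSpace N → ℝ := fun y =>
        γ / (2 * T ^ 2) * (y.2 ⟨0, by omega⟩ ^ 2 - y.2 ⟨N - 1, by omega⟩ ^ 2)
      let Pg : ℝ → PhaseSpace N → ℝ := fun s z => ∫ y, g y ∂(P.transitionKernel N T T s.toNNReal z)
      let w : PhaseSpace N → ℝ := fun z => ∫ s in Set.Ioi (0 : ℝ), Pg s z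
      let fL : PhaseSpace N → ℝ := fun y => γ * (y.2 ⟨0, by omega⟩ ^ 2 - T)
      let fR : PhaseSpace N → ℝ := fun y => γ * (y.2 ⟨N - 1, by omega⟩ ^ 2 - T)
      let PfL : ℝ → PhaseSpace N → ℝ := fun s z => ∫ y, fL y ∂(P.transitionKernel N T T s.toNNReal z)
      let PfR : ℝ → PhaseSpace N → ℝ := fun s z => ∫ y, fR y ∂(P.transitionKernel N T T s.toNNReal z)
      let QL : PhaseSpace N → ℝ := fun z => ∫ s in Set.Ioi (0 : ℝ), PfL s z
      let QR : PhaseSpace N → ℝ := fun z => ∫ s in Set.Ioi (0 : ℝ), PfR s z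
      (∀ z : PhaseSpace N, IntegrableOn (fun s => PfL s z) (Set.Ioi (0 : ℝ))) ∧
      (∀ z : PhaseSpace N, IntegrableOn (fun s => PfR s z) (Set.Ioi (0 : ℝ))) ∧
      MemLp QL 2 μT ∧ MemLp QR 2 μT ∧
      (∀ z : PhaseSpace N, w z = (QL z - QR z) / (2 * T ^ 2)) ∧
      ∫ z, (w z) ^ 2 ∂μT ≤ ((∫ z, (QL z) ^ 2 ∂μT) + ∫ z, (QR z) ^ 2 ∂μT) / (2 * T ^ 4) := by
  intro ω₂ lam β γ hω hl hβ hγ T hT N hN P μT _hINV hMIX g Pg w fL fR PfL PfR QL QR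
  have hN0 : 0 < N := by omega
  -- the weight exponent `ϑ = 1/(4T)` and the growth constant `γ (2/ϑ + T)`
  set ϑ : ℝ := 1 / (4 * T) with hϑ_def
  have hϑ : 0 < ϑ := by positivity
  have h2ϑ : 2 * ϑ < 1 / T := by
    rw [hϑ_def, show (2 : ℝ) * (1 / (4 * T)) = 1 / T * (1 / 2) by ring]
    exact mul_lt_of_lt_one_right (by positivity) (by norm_num)
  have hϑT : ϑ < 1 / T := by linarith
  have hM : 0 ≤ γ * (2 / ϑ + T) := by positivity
  -- the one-bath sources `γ (p_i² - T)`: continuity, growth, mean zero, kernel integrability, decay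
  have hfc : ∀ i : Fin N, Continuous fun y : PhaseSpace N => γ * (y.2 i ^ 2 - T) := fun i => by
    fun_prop
  have hfM : ∀ (i : Fin N) (y : PhaseSpace N),
      |γ * (y.2 i ^ 2 - T)| ≤ γ * (2 / ϑ + T) * Real.exp (ϑ * P.hamiltonian N y) := fun i y => by
    rw [abs_mul, abs_of_pos hγ, mul_assoc]
    exact mul_le_mul_of_nonneg_left (abs_sq_momentum_sub_le_exp hω hl.le hβ.le hϑ hT.le y i) hγ.le
  have hmean : ∀ i : Fin N,
      ∫ y, γ * (y.2 i ^ 2 - T) ∂((pinnedChain ω₂ lam β γ).gibbsMeasure N T) = 0 := fun i => by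
    rw [integral_const_mul, pinnedChain_integral_kinObs_gibbsMeasure hω hl.le hβ.le γ N hT i, mul_zero]
  obtain ⟨C, c, hC, hc, hmix⟩ := hMIX ϑ hϑ hϑT
  have hint : ∀ (i : Fin N) (t : ℝ≥0) (z : PhaseSpace N),
      Integrable (fun y : PhaseSpace N => γ * (y.2 i ^ 2 - T)) (P.transitionKernel N T T t z) :=
    fun i t z => integrable_transitionKernel_of_le_exp hω hl hβ hγ hT hN0 hϑ hϑT (hfc i) (hfM i) t z
  have hdecay : ∀ (i : Fin N) (z : PhaseSpace N) (t : ℝ≥0),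
      |∫ y, γ * (y.2 i ^ 2 - T) ∂(P.transitionKernel N T T t z)| ≤
        γ * (2 / ϑ + T) * C * Real.exp (ϑ * P.hamiltonian N z) * Real.exp (-c * t) := by
    intro i z t
    have h := abs_act_sub_mean_le_of_mix hmix (hfc i) hM (hfM i) z t
    rwa [hmean i, sub_zero] at h
  -- `corrector_window_of_decay` (the tool of S2a) for `f_L` and for `f_R`
  obtain ⟨hAL, hQL, -⟩ := corrector_window_of_decay hω hl hβ hγ hT hN0 hϑ h2ϑ hM hC.le hc
    (g := fL) (hfc ⟨0, hN0⟩) (hfM ⟨0, hN0⟩) (hdecay ⟨0, hN0⟩) PfL rfl _ rfl QL rfl _ rfl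
  obtain ⟨hAR, hQR, -⟩ := corrector_window_of_decay hω hl hβ hγ hT hN0 hϑ h2ϑ hM hC.le hc
    (g := fR) (hfc ⟨N - 1, by omega⟩) (hfM ⟨N - 1, by omega⟩) (hdecay ⟨N - 1, by omega⟩)
    PfR rfl _ rfl QR rfl _ rfl
  have hQL' : MemLp QL 2 μT := hQL
  have hQR' : MemLp QR 2 μT := hQR
  -- the pointwise splitting `g = (f_L - f_R)/(2T²)`, evolved (`dP_s(z,·)`) and integrated (`ds`)
  have hpt : ∀ y : PhaseSpace N, g y = (fL y - fR y) / (2 * T ^ 2) := fun y => by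
    show γ / (2 * T ^ 2) * (y.2 ⟨0, hN0⟩ ^ 2 - y.2 ⟨N - 1, by omega⟩ ^ 2) =
      (γ * (y.2 ⟨0, hN0⟩ ^ 2 - T) - γ * (y.2 ⟨N - 1, by omega⟩ ^ 2 - T)) / (2 * T ^ 2)
    ring
  have hintL : ∀ (s : ℝ) (z : PhaseSpace N), Integrable fL (P.transitionKernel N T T s.toNNReal z) :=
    fun s z => hint ⟨0, hN0⟩ s.toNNReal z
  have hintR : ∀ (s : ℝ) (z : PhaseSpace N), Integrable fR (P.transitionKernel N T T s.toNNReal z) :=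
    fun s z => hint ⟨N - 1, by omega⟩ s.toNNReal z
  have hPg : ∀ (s : ℝ) (z : PhaseSpace N), Pg s z = (PfL s z - PfR s z) / (2 * T ^ 2) := by
    intro s z
    show ∫ y, g y ∂(P.transitionKernel N T T s.toNNReal z) =
      ((∫ y, fL y ∂(P.transitionKernel N T T s.toNNReal z)) -
        ∫ y, fR y ∂(P.transitionKernel N T T s.toNNReal z)) / (2 * T ^ 2)
    rw [← integral_sub (hintL s z) (hintR s z), ← integral_div]
    exact integral_congr_ae (Eventually.of_forall hpt)
  have h5 : ∀ z : PhaseSpace N, w z = (QL z - QR z) / (2 * T ^ 2) := by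
    intro z
    show ∫ s in Set.Ioi (0 : ℝ), Pg s z =
      ((∫ s in Set.Ioi (0 : ℝ), PfL s z) - ∫ s in Set.Ioi (0 : ℝ), PfR s z) / (2 * T ^ 2)
    rw [← integral_sub (hAL z) (hAR z), ← integral_div]
    exact integral_congr_ae (Eventually.of_forall fun s => hPg s z)
  -- the `L²(μ_T)` bound `‖w‖² ≤ (‖Q_L‖² + ‖Q_R‖²)/(2T⁴)`
  have hsq : ∀ z : PhaseSpace N, (w z) ^ 2 = (1 / (2 * T ^ 2)) ^ 2 * (QL z - QR z) ^ 2 :=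
    fun z => by rw [h5 z]; ring
  have e1 : ∫ z, (w z) ^ 2 ∂μT = (1 / (2 * T ^ 2)) ^ 2 * ∫ z, (QL z - QR z) ^ 2 ∂μT := by
    rw [← integral_const_mul]
    exact integral_congr_ae (Eventually.of_forall hsq)
  refine ⟨hAL, hAR, hQL', hQR', h5, ?_⟩
  calc ∫ z, (w z) ^ 2 ∂μT = (1 / (2 * T ^ 2)) ^ 2 * ∫ z, (QL z - QR z) ^ 2 ∂μT := e1
    _ ≤ (1 / (2 * T ^ 2)) ^ 2 * (2 * ∫ z, (QL z) ^ 2 ∂μT + 2 * ∫ z, (QR z) ^ 2 ∂μT) :=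
        mul_le_mul_of_nonneg_left (integral_sub_sq_le_two_mul hQL' hQR') (by positivity)
    _ = ((∫ z, (QL z) ^ 2 ∂μT) + ∫ z, (QR z) ^ 2 ∂μT) / (2 * T ^ 4) := by ring

end Summit.AtomisticToContinuum.FouriersLaw.Theorems.ExtensiveSnapshotIrreversibility.ClausiusBudget

end
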